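import Mathlib
import Literature.NumberTheory.Sieve.LinearPairMoebiusWindowDecomp
import Literature.NumberTheory.Sieve.LinearPairKloostermanExpSum
import Literature.NumberTheory.Sieve.WeightedSawtoothSums
import Literature.NumberTheory.Sieve.ShiuTheoremProofs
import HarnessLib

/-!
# The balanced divisor window for a pair of linear congruences is `o(x)`
# (the Duke–Friedlander–Iwaniec range `σ > 5/11`)

Topic `Literature/NumberTheory/Sieve` (conclusion of `LinearPairMoebiusWindowDecomp.lean`,
`LinearPairMoebiusMainTerm.lean`, `LinearPairKloostermanExpSum.lean`, `WeightedSawtoothSums.lean`).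
For primitive linear forms `q₀n + a₀`, `q₁n + a₁` (`gcd(qᵢ,aᵢ) = 1`, `Δ = q₁a₀ − q₀a₁ ≠ 0`), the
Möbius–log weight of the BALANCED WINDOW

  `G_x(d₀,d₁) = [x^{1−η} < d₀d₁ ≤ x^{1+θ}] [x^σ < d₀] [x^σ < d₁] μ(d₀) log d₀ μ(d₁) log d₁`,

and the count `A(d; x) = #{n₀ < n ≤ x : d₀ ∣ q₀n + a₀, d₁ ∣ q₁n + a₁}`, we prove
(`window_pair_sum_isLittleO`): for `5/11 < σ < 1/2` there is `c > 0` such that for all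
`0 < θ, η ≤ c`, every threshold `n₀` and all box sides `x^{1−σ/2} ≤ Bᵢ(x) ≤ x²`,

  `Σ_{d₀ ≤ B₀(x), d₁ ≤ B₁(x)} G_x(d) A(d; x) = o(x)`.

Proof: `Σ G A = (x − n₀) M(x) + Ψ(n₀) − Ψ(x)` (`window_sum_decomp`); the main term
`M(x) ≪ 1/log x` (`LinearPairMoebius.abs_doubleSum_le`, Siegel–Walfisz strength); the sawtooth sums
`Ψ(y) = Σ_d [Sol] G ψ((y − ν_d)/lcm)` are treated by the weighted Erdős–Turán inequality
(`WeightedSawtooth.abs_sum_mul_saw_le`, here in the packaged form `abs_sum_saw_le_of_bounds`) with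
`V = ⌊x^{2c}⌋`, the exponential sums by the Duke–Friedlander–Iwaniec bound
`LinearPairKloosterman.norm_windowSum_le` (saving `x^{(11σ−5)/48}` at `θ = η = 0`), and the
`k = 0` term by the mass bound `sum_abs_window_weight_le`; `abs_psi_le` is the resulting uniform
bound `|Ψ(y)| ≪ x^{1−c} (log x)^6` (`y ≤ x`).  Everything here is PROVED.

## References

* W. Duke, J. Friedlander, H. Iwaniec, *Bilinear forms with Kloosterman fractions*, Invent. Math.
  128 (1997), 23–43, §1 (the application to the binary divisor problem in the balanced range).
  [folklore]
-/

open scoped BigOperators ArithmeticFunction.Moebius FourierTransform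
open Finset Real Filter Asymptotics

namespace Literature.NumberTheory.Sieve.LinearPairMoebius

open Literature.NumberTheory.Sieve.LinearCongruencePair
open Literature.NumberTheory.LFunctions.AFE (saw)

/-! ### The weighted Erdős–Turán inequality with uniform bounds on the exponential sums -/

/-- **Sawtooth sums from uniform exponential-sum bounds.**  If the twisted sums
`Σ_j w_j e(κ t_j)` (`1 ≤ κ ≤ V`) and `Σ_j |w_j| e(κ t_j)` (`0 < |κ| ≤ 5(2V+1)`) are all bounded by `E`
and `Σ_j |w_j| ≤ M₀`, then
`|Σ_j w_j ψ(t_j)| ≤ (1/π)(1 + log V) E + (3(2 + log(2V+1))/(2V+1)) (10(2V+1) E + M₀)`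
(`WeightedSawtooth.abs_sum_mul_saw_le`). [folklore] -/
theorem abs_sum_saw_le_of_bounds {ι : Type*} (s : Finset ι) (w t : ι → ℝ) {V : ℕ} (hV : 1 ≤ V)
    {E M₀ : ℝ} (hE0 : 0 ≤ E)
    (hE : ∀ κ : ℕ, 1 ≤ κ → κ ≤ V → ‖∑ j ∈ s, (w j : ℂ) * (𝐞 ((κ : ℝ) * t j) : ℂ)‖ ≤ E)
    (hE' : ∀ κ : ℤ, κ ≠ 0 → |κ| ≤ 5 * (2 * V + 1) →
      ‖∑ j ∈ s, ((|w j| : ℝ) : ℂ) * (𝐞 ((κ : ℝ) * t j) : ℂ)‖ ≤ E)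
    (hM : ∑ j ∈ s, |w j| ≤ M₀) :
    |∑ j ∈ s, w j * saw (t j)| ≤
      (1 / π) * (1 + Real.log V) * E +
        3 * (2 + Real.log (2 * V + 1)) / (2 * V + 1) * (10 * (2 * V + 1) * E + M₀) := by
  have h := WeightedSawtooth.abs_sum_mul_saw_le s w t hV
  refine h.trans (add_le_add ?_ ?_)
  · -- the truncated series
    rw [mul_assoc]
    refine mul_le_mul_of_nonneg_left ?_ (by positivity)
    calc ∑ ν ∈ Icc 1 V, ‖∑ j ∈ s, (w j : ℂ) * (𝐞 ((ν : ℝ) * t j) : ℂ)‖ / ν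
        ≤ ∑ ν ∈ Icc 1 V, E * ((1 : ℝ) / ν) := by
          refine Finset.sum_le_sum fun ν hν => ?_
          rw [Finset.mem_Icc] at hν
          rw [mul_one_div]
          exact div_le_div_of_nonneg_right (hE ν hν.1 hν.2) (Nat.cast_nonneg _)
      _ = E * ∑ ν ∈ Icc 1 V, (1 : ℝ) / ν := by rw [Finset.mul_sum]
      _ ≤ E * (1 + Real.log V) :=
          mul_le_mul_of_nonneg_left (Shiu.sum_Icc_inv_le_one_add_log V) hE0
      _ = (1 + Real.log V) * E := by ring
  · -- the majorant
    have hlog : 0 ≤ Real.log (2 * V + 1) := Real.log_nonneg (by linarith)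
    refine mul_le_mul_of_nonneg_left ?_ (by positivity)
    set H : ℕ := 5 * (2 * V + 1) with hH
    have h0mem : (0 : ℤ) ∈ Icc (-(H : ℤ)) H := by
      rw [Finset.mem_Icc]; constructor <;> omega
    rw [← Finset.add_sum_erase _ _ h0mem]
    rw [add_comm]
    refine add_le_add ?_ ?_
    · calc ∑ κ ∈ (Icc (-(H : ℤ)) H).erase 0, ‖∑ j ∈ s, ((|w j| : ℝ) : ℂ) * (𝐞 ((κ : ℝ) * t j) : ℂ)‖
          ≤ ∑ _κ ∈ (Icc (-(H : ℤ)) H).erase 0, E := by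
            refine Finset.sum_le_sum fun κ hκ => ?_
            rw [Finset.mem_erase, Finset.mem_Icc] at hκ
            exact hE' κ hκ.1 (abs_le.2 ⟨by omega, by omega⟩)
        _ = (((Icc (-(H : ℤ)) H).erase 0).card : ℝ) * E := by rw [Finset.sum_const, nsmul_eq_mul]
        _ = 10 * (2 * V + 1) * E := by
            rw [Finset.card_erase_of_mem h0mem, Int.card_Icc]
            have : ((H : ℤ) + 1 - -(H : ℤ)).toNat = 2 * H + 1 := by omega
            rw [this, hH]
            push_cast
            ring
    · have e0 : ∑ j ∈ s, ((|w j| : ℝ) : ℂ) * (𝐞 (((0 : ℤ) : ℝ) * t j) : ℂ) =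
          ((∑ j ∈ s, |w j| : ℝ) : ℂ) := by
        push_cast
        refine Finset.sum_congr rfl fun j _ => ?_
        rw [zero_mul, AddChar.map_zero_eq_one, Circle.coe_one, mul_one]
      rw [e0, Complex.norm_real, Real.norm_eq_abs,
        abs_of_nonneg (Finset.sum_nonneg fun j _ => abs_nonneg _)]
      exact hM

/-- `abs_sum_saw_le_of_bounds` for a product index set, with double sums throughout. [folklore] -/
theorem abs_sum_saw_le_of_bounds₂ (s s' : Finset ℕ) (W T : ℕ → ℕ → ℝ) {V : ℕ} (hV : 1 ≤ V)
    {E M₀ : ℝ} (hE0 : 0 ≤ E)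
    (hE : ∀ κ : ℕ, 1 ≤ κ → κ ≤ V →
      ‖∑ d₀ ∈ s, ∑ d₁ ∈ s', (W d₀ d₁ : ℂ) * (𝐞 ((κ : ℝ) * T d₀ d₁) : ℂ)‖ ≤ E)
    (hE' : ∀ κ : ℤ, κ ≠ 0 → |κ| ≤ 5 * (2 * V + 1) →
      ‖∑ d₀ ∈ s, ∑ d₁ ∈ s', ((|W d₀ d₁| : ℝ) : ℂ) * (𝐞 ((κ : ℝ) * T d₀ d₁) : ℂ)‖ ≤ E)
    (hM : ∑ d₀ ∈ s, ∑ d₁ ∈ s', |W d₀ d₁| ≤ M₀) :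
    |∑ d₀ ∈ s, ∑ d₁ ∈ s', W d₀ d₁ * saw (T d₀ d₁)| ≤
      (1 / π) * (1 + Real.log V) * E +
        3 * (2 + Real.log (2 * V + 1)) / (2 * V + 1) * (10 * (2 * V + 1) * E + M₀) := by
  have h := abs_sum_saw_le_of_bounds (E := E) (M₀ := M₀) (s ×ˢ s') (fun p => W p.1 p.2)
    (fun p => T p.1 p.2) hV hE0
    (fun κ h1 h2 => by rw [Finset.sum_product]; exact hE κ h1 h2)
    (fun κ h1 h2 => by rw [Finset.sum_product]; exact hE' κ h1 h2)
    (by rw [Finset.sum_product]; exact hM)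
  rw [Finset.sum_product] at h
  exact h

/-! ### Small real-variable facts for the choice `V = ⌊x^{2c}⌋` -/

section Facts

variable {x : ℕ} {c : ℝ}

/-- Facts about `V = ⌊x^{2c}⌋` for `x ≥ 1`: `1 ≤ V`, `V ≤ x^{2c} ≤ 2V + 1 ≤ 3x^{2c}`,
`5(2V+1) ≤ 20 x^{2c}`. [folklore] -/
theorem floor_rpow_facts (hx : 1 ≤ x) (hc : 0 ≤ c) :
    1 ≤ ⌊(x : ℝ) ^ (2 * c)⌋₊ ∧ (⌊(x : ℝ) ^ (2 * c)⌋₊ : ℝ) ≤ (x : ℝ) ^ (2 * c) ∧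
      (x : ℝ) ^ (2 * c) ≤ 2 * (⌊(x : ℝ) ^ (2 * c)⌋₊ : ℝ) + 1 ∧
      2 * (⌊(x : ℝ) ^ (2 * c)⌋₊ : ℝ) + 1 ≤ 3 * (x : ℝ) ^ (2 * c) ∧
      ((5 * (2 * ⌊(x : ℝ) ^ (2 * c)⌋₊ + 1) : ℕ) : ℝ) ≤ 20 * (x : ℝ) ^ (2 * c) := by
  have hx1 : (1 : ℝ) ≤ x := by exact_mod_cast hx
  have hX1 : (1 : ℝ) ≤ (x : ℝ) ^ (2 * c) := Real.one_le_rpow hx1 (by linarith)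
  have hX0 : (0 : ℝ) ≤ (x : ℝ) ^ (2 * c) := by linarith
  have h1 : 1 ≤ ⌊(x : ℝ) ^ (2 * c)⌋₊ := Nat.le_floor (by simpa using hX1)
  have h2 : (⌊(x : ℝ) ^ (2 * c)⌋₊ : ℝ) ≤ (x : ℝ) ^ (2 * c) := Nat.floor_le hX0
  have h3 : (x : ℝ) ^ (2 * c) < (⌊(x : ℝ) ^ (2 * c)⌋₊ : ℝ) + 1 := Nat.lt_floor_add_one _
  refine ⟨h1, h2, by linarith, by linarith, ?_⟩
  push_cast
  linarith

/-- `log V ≤ log x` and `log(2V+1) ≤ 2 log x` for `V = ⌊x^{2c}⌋`, `0 ≤ c ≤ 1/2`, `x ≥ 6`.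
[folklore] -/
theorem log_floor_rpow_le (hx : 6 ≤ x) (hc : 0 ≤ c) (hc2 : c ≤ 1 / 2) :
    Real.log (⌊(x : ℝ) ^ (2 * c)⌋₊ : ℝ) ≤ Real.log x ∧
      Real.log (2 * (⌊(x : ℝ) ^ (2 * c)⌋₊ : ℝ) + 1) ≤ 2 * Real.log x := by
  have hx1N : 1 ≤ x := le_trans (by norm_num) hx
  obtain ⟨hV1, hV2, -, hV4, -⟩ := floor_rpow_facts hx1N hc
  have hx6 : (6 : ℝ) ≤ x := by exact_mod_cast hx
  have hx0 : (0 : ℝ) < x := by linarith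
  have hx1 : (1 : ℝ) ≤ x := by linarith
  have hL6 : Real.log 6 ≤ Real.log x := Real.log_le_log (by norm_num) hx6
  have hL3 : Real.log 3 ≤ Real.log x := (Real.log_le_log (by norm_num) (by norm_num)).trans hL6
  have hLx : Real.log ((x : ℝ) ^ (2 * c)) ≤ Real.log x := by
    rw [Real.log_rpow hx0]
    have : 0 ≤ Real.log x := Real.log_nonneg hx1
    nlinarith
  have hV0 : (0 : ℝ) < ⌊(x : ℝ) ^ (2 * c)⌋₊ := by exact_mod_cast hV1
  constructor
  · exact (Real.log_le_log hV0 hV2).trans hLx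
  · calc Real.log (2 * (⌊(x : ℝ) ^ (2 * c)⌋₊ : ℝ) + 1) ≤ Real.log (3 * (x : ℝ) ^ (2 * c)) :=
          Real.log_le_log (by linarith) hV4
      _ = Real.log 3 + Real.log ((x : ℝ) ^ (2 * c)) := by
          rw [Real.log_mul (by norm_num) (by positivity)]
      _ ≤ 2 * Real.log x := by linarith

/-- `|κ|^{11/8} ≤ 100 x^{(11/4)c}` for `|κ| ≤ 20 x^{2c}` (`20^{11/8} ≤ 20^{3/2} ≤ 100`). [folklore] -/
theorem abs_rpow_le_of_le (hx : 1 ≤ x) {κ : ℝ} (hκ : |κ| ≤ 20 * (x : ℝ) ^ (2 * c)) :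
    |κ| ^ (11 / 8 : ℝ) ≤ 100 * (x : ℝ) ^ ((11 / 4) * c) := by
  have hx1 : (1 : ℝ) ≤ x := by exact_mod_cast hx
  have hx0 : (0 : ℝ) ≤ x := by linarith
  have h20 : (20 : ℝ) ^ (11 / 8 : ℝ) ≤ 100 := by
    calc (20 : ℝ) ^ (11 / 8 : ℝ) ≤ (20 : ℝ) ^ (3 / 2 : ℝ) :=
          Real.rpow_le_rpow_of_exponent_le (by norm_num) (by norm_num)
      _ = 20 * Real.sqrt 20 := by
          rw [show (3 / 2 : ℝ) = 1 + 1 / 2 by norm_num, Real.rpow_add (by norm_num), Real.rpow_one,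
            Real.sqrt_eq_rpow]
      _ ≤ 20 * 5 := by
          refine mul_le_mul_of_nonneg_left ?_ (by norm_num)
          rw [Real.sqrt_le_left (by norm_num)]; norm_num
      _ = 100 := by norm_num
  calc |κ| ^ (11 / 8 : ℝ) ≤ (20 * (x : ℝ) ^ (2 * c)) ^ (11 / 8 : ℝ) :=
        Real.rpow_le_rpow (abs_nonneg _) hκ (by norm_num)
    _ = (20 : ℝ) ^ (11 / 8 : ℝ) * (x : ℝ) ^ ((11 / 4) * c) := by
        rw [Real.mul_rpow (by norm_num) (by positivity), ← Real.rpow_mul hx0]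
        congr 2; ring
    _ ≤ 100 * (x : ℝ) ^ ((11 / 4) * c) :=
        mul_le_mul_of_nonneg_right h20 (by positivity)

end Facts

/-! ### The sawtooth sums of the balanced window are `≪ x^{1−c} (log x)^6` -/

section Psi

variable {q₀ q₁ : ℕ} {a₀ a₁ : ℤ}

/-- `|μ(d) log d| ≤ log B` for `1 ≤ d ≤ B`. [folklore] -/
theorem abs_moebius_log_le {d B : ℕ} (hd : 1 ≤ d) (hdB : d ≤ B) :
    |(μ d : ℝ) * Real.log d| ≤ Real.log B := by
  rw [abs_mul, abs_of_nonneg (Real.log_nonneg (by exact_mod_cast hd))]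
  have hμ : |(μ d : ℝ)| ≤ 1 := by exact_mod_cast ArithmeticFunction.abs_moebius_le_one
  have hlog : Real.log d ≤ Real.log B := Real.log_le_log (by exact_mod_cast hd) (by exact_mod_cast hdB)
  have h0 : 0 ≤ Real.log d := Real.log_nonneg (by exact_mod_cast hd)
  nlinarith

/-- The final numerics of `abs_psi_le`, in scalar form: with `L ≥ 1`, `V ≥ 1`, `log V ≤ L`,
`log(2V+1) ≤ 2L`, `R ≤ 2V + 1`, `P ≤ Q R`, `E = 400 K L⁵ Q`,
`(1/π)(1 + log V) E + (3(2 + log(2V+1))/(2V+1)) (10(2V+1)E + 12 L³ P) ≤ (48400K + 144) L⁶ Q`.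
[folklore] -/
theorem psi_numerics {L V E K P Q R : ℝ} (hL : 1 ≤ L) (hV : 1 ≤ V) (hK : 0 ≤ K) (hQ : 0 ≤ Q)
    (hP : 0 ≤ P) (hlogV : Real.log V ≤ L) (hlog2V : Real.log (2 * V + 1) ≤ 2 * L)
    (hRV : R ≤ 2 * V + 1) (hPQ : P ≤ Q * R) (hE : E = 400 * K * L ^ 5 * Q) :
    1 / π * (1 + Real.log V) * E +
        3 * (2 + Real.log (2 * V + 1)) / (2 * V + 1) * (10 * (2 * V + 1) * E + 12 * L ^ 3 * P) ≤
      (48400 * K + 144) * L ^ 6 * Q := by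
  have hV0 : 0 < 2 * V + 1 := by linarith
  have hE0 : 0 ≤ E := by rw [hE]; positivity
  have hl0 : 0 ≤ Real.log (2 * V + 1) := Real.log_nonneg (by linarith)
  -- `(1/π)(1 + log V) ≤ L`
  have hA : 1 / π * (1 + Real.log V) ≤ L := by
    have hπ : (2 : ℝ) ≤ π := by have := Real.pi_gt_three; linarith
    rw [div_mul_eq_mul_div, one_mul, div_le_iff₀ Real.pi_pos]
    nlinarith
  -- `c_V · 10(2V+1) E ≤ 120 L E`
  have hB : 3 * (2 + Real.log (2 * V + 1)) / (2 * V + 1) * (10 * (2 * V + 1) * E) ≤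
      120 * L * E := by
    have heq : 3 * (2 + Real.log (2 * V + 1)) / (2 * V + 1) * (10 * (2 * V + 1) * E) =
        30 * (2 + Real.log (2 * V + 1)) * E := by
      field_simp
      ring
    rw [heq]
    have h4 : 2 + Real.log (2 * V + 1) ≤ 4 * L := by linarith
    nlinarith
  -- `c_V · 12 L³ P ≤ 144 L⁶ Q`
  have hC : 3 * (2 + Real.log (2 * V + 1)) / (2 * V + 1) * (12 * L ^ 3 * P) ≤ 144 * L ^ 6 * Q := by
    have h1 : 3 * (2 + Real.log (2 * V + 1)) ≤ 12 * L := by linarith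
    have h2 : P / (2 * V + 1) ≤ Q := by
      rw [div_le_iff₀ hV0]
      calc P ≤ Q * R := hPQ
        _ ≤ Q * (2 * V + 1) := mul_le_mul_of_nonneg_left hRV hQ
    have h3 : L ^ 4 ≤ L ^ 6 := pow_le_pow_right₀ hL (by norm_num)
    calc 3 * (2 + Real.log (2 * V + 1)) / (2 * V + 1) * (12 * L ^ 3 * P)
        = 3 * (2 + Real.log (2 * V + 1)) * (12 * L ^ 3) * (P / (2 * V + 1)) := by
          field_simp
      _ ≤ (12 * L) * (12 * L ^ 3) * Q := by
          refine mul_le_mul (mul_le_mul_of_nonneg_right h1 (by positivity)) h2 (by positivity)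
            (by positivity)
      _ = 144 * L ^ 4 * Q := by ring
      _ ≤ 144 * L ^ 6 * Q := by gcongr
  have hAE : 1 / π * (1 + Real.log V) * E ≤ L * E := mul_le_mul_of_nonneg_right hA hE0
  have hE1 : L * E + 120 * L * E = 48400 * K * L ^ 6 * Q := by rw [hE]; ring
  rw [mul_add]
  nlinarith

/-- **The sawtooth sums of the balanced window.**  Let `Kw, ε` be such that the exponential-sum
bound of `LinearPairKloosterman.norm_windowSum_le` holds with constant `Kw` and exponent
`η + 7(1+θ)/8 + (1+θ−σ)(11/48+ε)`, let `0 < c ≤ min(σ/2, 1/2)`, `0 < θ, η ≤ c` with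
`η + 7(1+θ)/8 + (1+θ−σ)(11/48+ε) + (11/4)c ≤ 1 − c`, and let `x ≥ 6`, `|a₀| ≤ x`, `2D ≤ x^σ`,
`x^{1−σ/2} ≤ Bᵢ ≤ x²`, `y ≤ x`.  Then for the window weight
`W(d) = [Sol(d)][x^{1−η} < d₀d₁ ≤ x^{1+θ}][x^σ < dᵢ] μ(d₀)log d₀ μ(d₁)log d₁` and any solution map `ν`,
`|Σ_{d₀ ≤ B₀, d₁ ≤ B₁} W(d) ψ((y − ν_d)/lcm(d₀,d₁))| ≤ (48400 Kw + 144) (log x)^6 x^{1−c}`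
(Erdős–Turán with `V = ⌊x^{2c}⌋`, Duke–Friedlander–Iwaniec for `0 < |k| ≤ 5(2V+1)`, and the mass
bound for `k = 0`). [folklore] -/
theorem abs_psi_le {ε Kw : ℝ} (hKw0 : 0 ≤ Kw)
    (hKw : ∀ (σ θ η : ℝ) (x : ℕ), 0 < σ → 0 < θ → θ ≤ σ → θ ≤ 1 → 0 < η → η ≤ 1 →
      6 ≤ x → |(a₀ : ℝ)| ≤ x →
      2 * ((((q₁ : ℤ) * a₀ - (q₀ : ℤ) * a₁).natAbs : ℕ) : ℝ) ≤ (x : ℝ) ^ σ →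
      ∀ (X₀ X₁ : ℕ), (x : ℝ) ^ (1 + θ - σ) ≤ X₀ → (x : ℝ) ^ (1 + θ - σ) ≤ X₁ →
      ∀ (k : ℤ), k ≠ 0 → ∀ (y : ℝ), |y| ≤ x →
      ∀ (G₀ G₁ : ℝ), 0 ≤ G₀ → 0 ≤ G₁ → ∀ (v₀ v₁ : ℕ → ℂ), (∀ d, ‖v₀ d‖ ≤ G₀) →
      (∀ d, ‖v₁ d‖ ≤ G₁) → (∀ d, v₁ d ≠ 0 → Squarefree d) →
      ∀ (ν : ℕ → ℕ → ℕ), (∀ d₀ d₁ : ℕ, 0 < d₀ → 0 < d₁ → Nat.Coprime d₀ q₀ → Nat.Coprime d₁ q₁ →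
        ((Nat.gcd d₀ d₁ : ℕ) : ℤ) ∣ (q₁ : ℤ) * a₀ - (q₀ : ℤ) * a₁ →
          (d₀ : ℤ) ∣ (q₀ : ℤ) * (ν d₀ d₁) + a₀ ∧ (d₁ : ℤ) ∣ (q₁ : ℤ) * (ν d₀ d₁) + a₁) →
      ‖∑ d₀ ∈ Icc 1 X₀, ∑ d₁ ∈ Icc 1 X₁,
          (if ((Nat.Coprime d₀ q₀ ∧ Nat.Coprime d₁ q₁ ∧
                ((Nat.gcd d₀ d₁ : ℕ) : ℤ) ∣ (q₁ : ℤ) * a₀ - (q₀ : ℤ) * a₁) ∧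
              ((x : ℝ) ^ (1 - η) < (d₀ : ℝ) * d₁ ∧ (d₀ : ℝ) * d₁ ≤ (x : ℝ) ^ (1 + θ) ∧
                (x : ℝ) ^ σ < (d₀ : ℝ) ∧ (x : ℝ) ^ σ < (d₁ : ℝ))) then
            v₀ d₀ * v₁ d₁ * Complex.exp (2 * π * Complex.I *
              (((k : ℝ) * ((y - (ν d₀ d₁ : ℝ)) / ((Nat.lcm d₀ d₁ : ℕ) : ℝ)) : ℝ) : ℂ))
          else 0)‖ ≤
        Kw * G₀ * G₁ * |(k : ℝ)| ^ (11 / 8 : ℝ) *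
          (x : ℝ) ^ (η + (1 + θ) * (7 / 8) + (1 + θ - σ) * (11 / 48 + ε)) * Real.log x ^ 3)
    {σ θ η c : ℝ} (hσ : 0 < σ) (hσ1 : σ ≤ 1) (hc : 0 < c) (hcσ : c ≤ σ / 2) (hc2 : c ≤ 1 / 2)
    (hθ : 0 < θ) (hθc : θ ≤ c) (hη : 0 < η) (hηc : η ≤ c)
    (hexp : η + (1 + θ) * (7 / 8) + (1 + θ - σ) * (11 / 48 + ε) + (11 / 4) * c ≤ 1 - c)
    {x : ℕ} (hx : 6 ≤ x) (ha₀ : |(a₀ : ℝ)| ≤ x)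
    (h2D : 2 * ((((q₁ : ℤ) * a₀ - (q₀ : ℤ) * a₁).natAbs : ℕ) : ℝ) ≤ (x : ℝ) ^ σ)
    {B₀ B₁ : ℕ} (hB₀ : (x : ℝ) ^ (1 - σ / 2) ≤ B₀) (hB₀' : (B₀ : ℝ) ≤ (x : ℝ) ^ 2)
    (hB₁ : (x : ℝ) ^ (1 - σ / 2) ≤ B₁) (hB₁' : (B₁ : ℝ) ≤ (x : ℝ) ^ 2)
    (ν : ℕ → ℕ → ℕ)
    (hν : ∀ d₀ d₁ : ℕ, 0 < d₀ → 0 < d₁ → Nat.Coprime d₀ q₀ → Nat.Coprime d₁ q₁ →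
      ((Nat.gcd d₀ d₁ : ℕ) : ℤ) ∣ (q₁ : ℤ) * a₀ - (q₀ : ℤ) * a₁ →
        (d₀ : ℤ) ∣ (q₀ : ℤ) * (ν d₀ d₁) + a₀ ∧ (d₁ : ℤ) ∣ (q₁ : ℤ) * (ν d₀ d₁) + a₁)
    {y : ℕ} (hy : y ≤ x) :
    |∑ d₀ ∈ Icc 1 B₀, ∑ d₁ ∈ Icc 1 B₁,
        (if (Nat.Coprime d₀ q₀ ∧ Nat.Coprime d₁ q₁ ∧
            ((Nat.gcd d₀ d₁ : ℕ) : ℤ) ∣ (q₁ : ℤ) * a₀ - (q₀ : ℤ) * a₁) then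
          (if ((x : ℝ) ^ (1 - η) < (d₀ : ℝ) * d₁ ∧ (d₀ : ℝ) * d₁ ≤ (x : ℝ) ^ (1 + θ) ∧
              (x : ℝ) ^ σ < (d₀ : ℝ) ∧ (x : ℝ) ^ σ < (d₁ : ℝ)) then
            (μ d₀ : ℝ) * Real.log d₀ * ((μ d₁ : ℝ) * Real.log d₁) else 0) else 0) *
          saw (((y : ℝ) - ν d₀ d₁) / (Nat.lcm d₀ d₁ : ℕ))| ≤
      (48400 * Kw + 144) * Real.log x ^ 6 * (x : ℝ) ^ (1 - c) := by
  classical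
  -- sizes
  have hx1N : 1 ≤ x := le_trans (by norm_num) hx
  have hx6 : (6 : ℝ) ≤ x := by exact_mod_cast hx
  have hx0 : (0 : ℝ) < x := by linarith
  have hx1 : (1 : ℝ) ≤ x := by linarith
  have hL1 : 1 ≤ Real.log x := by
    rw [Real.le_log_iff_exp_le hx0]
    have := Real.exp_one_lt_d9; linarith
  have hL0 : 0 ≤ Real.log x := by linarith
  have hxσ2 : (1 : ℝ) ≤ (x : ℝ) ^ (1 - σ / 2) := Real.one_le_rpow hx1 (by linarith)
  have hB₀1 : 1 ≤ B₀ := by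
    have : (1 : ℝ) ≤ B₀ := hxσ2.trans hB₀
    exact_mod_cast this
  have hB₁1 : 1 ≤ B₁ := by
    have : (1 : ℝ) ≤ B₁ := hxσ2.trans hB₁
    exact_mod_cast this
  have hlogx2 : Real.log ((x : ℝ) ^ 2) = 2 * Real.log x := by
    rw [show ((x : ℝ) ^ 2) = (x : ℝ) ^ (2 : ℝ) by norm_cast, Real.log_rpow hx0]
  have hlogB₀ : Real.log B₀ ≤ 2 * Real.log x := by
    rw [← hlogx2]; exact Real.log_le_log (by exact_mod_cast hB₀1) hB₀'
  have hlogB₁ : Real.log B₁ ≤ 2 * Real.log x := by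
    rw [← hlogx2]; exact Real.log_le_log (by exact_mod_cast hB₁1) hB₁'
  have hXB : (x : ℝ) ^ (1 + θ - σ) ≤ (x : ℝ) ^ (1 - σ / 2) :=
    Real.rpow_le_rpow_of_exponent_le hx1 (by linarith)
  have hXB₀ : (x : ℝ) ^ (1 + θ - σ) ≤ B₀ := hXB.trans hB₀
  have hXB₁ : (x : ℝ) ^ (1 + θ - σ) ≤ B₁ := hXB.trans hB₁
  have hyx : |((y : ℕ) : ℝ)| ≤ x := by
    rw [abs_of_nonneg (Nat.cast_nonneg y)]; exact_mod_cast hy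
  -- `V = ⌊x^{2c}⌋`
  obtain ⟨hV1, hV2, hV3, hV4, hV5⟩ := floor_rpow_facts hx1N hc.le
  obtain ⟨hlogV, hlog2V⟩ := log_floor_rpow_le hx hc.le hc2
  have hV0 : (0 : ℝ) < 2 * (⌊(x : ℝ) ^ (2 * c)⌋₊ : ℝ) + 1 := by positivity
  -- the exponent
  have hxe : (x : ℝ) ^ ((11 / 4) * c) *
      (x : ℝ) ^ (η + (1 + θ) * (7 / 8) + (1 + θ - σ) * (11 / 48 + ε)) ≤ (x : ℝ) ^ (1 - c) := by
    rw [← Real.rpow_add hx0]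
    exact Real.rpow_le_rpow_of_exponent_le hx1 (by linarith)
  -- the uniform exponential-sum bound `E`
  set E : ℝ := 400 * Kw * Real.log x ^ 5 * (x : ℝ) ^ (1 - c) with hEdef
  have hE0 : 0 ≤ E := by rw [hEdef]; positivity
  -- truncated weights
  set v₀ : ℕ → ℂ := fun d => if d ≤ B₀ then (((μ d : ℝ) * Real.log d : ℝ) : ℂ) else 0 with hv₀
  set v₁ : ℕ → ℂ := fun d => if d ≤ B₁ then (((μ d : ℝ) * Real.log d : ℝ) : ℂ) else 0 with hv₁
  set u₀ : ℕ → ℂ := fun d => if d ≤ B₀ then (((|(μ d : ℝ)| * Real.log d : ℝ)) : ℂ) else 0 with hu₀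
  set u₁ : ℕ → ℂ := fun d => if d ≤ B₁ then (((|(μ d : ℝ)| * Real.log d : ℝ)) : ℂ) else 0 with hu₁
  have hv₀b : ∀ d, ‖v₀ d‖ ≤ 2 * Real.log x := fun d =>
    ((norm_trunc_weight_le hB₀1 d).1).trans hlogB₀
  have hv₁b : ∀ d, ‖v₁ d‖ ≤ 2 * Real.log x := fun d =>
    ((norm_trunc_weight_le hB₁1 d).1).trans hlogB₁
  have hu₀b : ∀ d, ‖u₀ d‖ ≤ 2 * Real.log x := fun d =>
    ((norm_trunc_weight_le hB₀1 d).2).trans hlogB₀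
  have hu₁b : ∀ d, ‖u₁ d‖ ≤ 2 * Real.log x := fun d =>
    ((norm_trunc_weight_le hB₁1 d).2).trans hlogB₁
  have hv₁s : ∀ d, v₁ d ≠ 0 → Squarefree d := fun d => (trunc_weight_ne_zero (B := B₁) (d := d)).1
  have hu₁s : ∀ d, u₁ d ≠ 0 → Squarefree d := fun d => (trunc_weight_ne_zero (B := B₁) (d := d)).2
  -- the common final step of the two exponential-sum bounds
  have hfin : ∀ κ : ℝ, |κ| ≤ 20 * (x : ℝ) ^ (2 * c) →
      Kw * (2 * Real.log x) * (2 * Real.log x) * |κ| ^ (11 / 8 : ℝ) *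
        (x : ℝ) ^ (η + (1 + θ) * (7 / 8) + (1 + θ - σ) * (11 / 48 + ε)) * Real.log x ^ 3 ≤ E := by
    intro κ hκ
    have hk := abs_rpow_le_of_le hx1N hκ
    calc Kw * (2 * Real.log x) * (2 * Real.log x) * |κ| ^ (11 / 8 : ℝ) *
          (x : ℝ) ^ (η + (1 + θ) * (7 / 8) + (1 + θ - σ) * (11 / 48 + ε)) * Real.log x ^ 3
        ≤ Kw * (2 * Real.log x) * (2 * Real.log x) * (100 * (x : ℝ) ^ ((11 / 4) * c)) *
          (x : ℝ) ^ (η + (1 + θ) * (7 / 8) + (1 + θ - σ) * (11 / 48 + ε)) * Real.log x ^ 3 := by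
          gcongr
      _ = 400 * Kw * Real.log x ^ 5 * ((x : ℝ) ^ ((11 / 4) * c) *
          (x : ℝ) ^ (η + (1 + θ) * (7 / 8) + (1 + θ - σ) * (11 / 48 + ε))) := by ring
      _ ≤ E := by rw [hEdef]; gcongr
  -- apply the packaged Erdős–Turán inequality
  refine (abs_sum_saw_le_of_bounds₂ (E := E) (M₀ := 12 * Real.log x ^ 3 * (x : ℝ) ^ (1 + θ))
    (Icc 1 B₀) (Icc 1 B₁)
    (fun d₀ d₁ => (if (Nat.Coprime d₀ q₀ ∧ Nat.Coprime d₁ q₁ ∧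
        ((Nat.gcd d₀ d₁ : ℕ) : ℤ) ∣ (q₁ : ℤ) * a₀ - (q₀ : ℤ) * a₁) then
      (if ((x : ℝ) ^ (1 - η) < (d₀ : ℝ) * d₁ ∧ (d₀ : ℝ) * d₁ ≤ (x : ℝ) ^ (1 + θ) ∧
          (x : ℝ) ^ σ < (d₀ : ℝ) ∧ (x : ℝ) ^ σ < (d₁ : ℝ)) then
        (μ d₀ : ℝ) * Real.log d₀ * ((μ d₁ : ℝ) * Real.log d₁) else 0) else 0))
    (fun d₀ d₁ => ((y : ℝ) - ν d₀ d₁) / (Nat.lcm d₀ d₁ : ℕ)) hV1 hE0 ?_ ?_ ?_).trans ?_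
  · -- `1 ≤ κ ≤ V`
    intro κ hκ1 hκV
    have hconv : ∀ d₀ ∈ Icc 1 B₀, ∀ d₁ ∈ Icc 1 B₁,
        (((if (Nat.Coprime d₀ q₀ ∧ Nat.Coprime d₁ q₁ ∧
            ((Nat.gcd d₀ d₁ : ℕ) : ℤ) ∣ (q₁ : ℤ) * a₀ - (q₀ : ℤ) * a₁) then
          (if ((x : ℝ) ^ (1 - η) < (d₀ : ℝ) * d₁ ∧ (d₀ : ℝ) * d₁ ≤ (x : ℝ) ^ (1 + θ) ∧
              (x : ℝ) ^ σ < (d₀ : ℝ) ∧ (x : ℝ) ^ σ < (d₁ : ℝ)) then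
            (μ d₀ : ℝ) * Real.log d₀ * ((μ d₁ : ℝ) * Real.log d₁) else 0) else 0 : ℝ) : ℂ) *
          (𝐞 ((κ : ℝ) * (((y : ℝ) - ν d₀ d₁) / (Nat.lcm d₀ d₁ : ℕ))) : ℂ)) =
        (if ((Nat.Coprime d₀ q₀ ∧ Nat.Coprime d₁ q₁ ∧
              ((Nat.gcd d₀ d₁ : ℕ) : ℤ) ∣ (q₁ : ℤ) * a₀ - (q₀ : ℤ) * a₁) ∧
            ((x : ℝ) ^ (1 - η) < (d₀ : ℝ) * d₁ ∧ (d₀ : ℝ) * d₁ ≤ (x : ℝ) ^ (1 + θ) ∧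
              (x : ℝ) ^ σ < (d₀ : ℝ) ∧ (x : ℝ) ^ σ < (d₁ : ℝ))) then
          v₀ d₀ * v₁ d₁ * Complex.exp (2 * π * Complex.I *
            ((((κ : ℤ) : ℝ) * ((((y : ℕ) : ℝ) - (ν d₀ d₁ : ℝ)) / ((Nat.lcm d₀ d₁ : ℕ) : ℝ)) : ℝ) : ℂ))
        else 0) := by
      intro d₀ hd₀ d₁ hd₁
      have h0 : d₀ ≤ B₀ := (Finset.mem_Icc.1 hd₀).2
      have h1 : d₁ ≤ B₁ := (Finset.mem_Icc.1 hd₁).2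
      simp only [hv₀, hv₁, if_pos h0, if_pos h1, Int.cast_natCast]
      by_cases hs : (Nat.Coprime d₀ q₀ ∧ Nat.Coprime d₁ q₁ ∧
          ((Nat.gcd d₀ d₁ : ℕ) : ℤ) ∣ (q₁ : ℤ) * a₀ - (q₀ : ℤ) * a₁)
      · by_cases hw : ((x : ℝ) ^ (1 - η) < (d₀ : ℝ) * d₁ ∧ (d₀ : ℝ) * d₁ ≤ (x : ℝ) ^ (1 + θ) ∧
            (x : ℝ) ^ σ < (d₀ : ℝ) ∧ (x : ℝ) ^ σ < (d₁ : ℝ))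
        · rw [if_pos hs, if_pos hw, if_pos ⟨hs, hw⟩, fourierChar_coe_eq_exp]
          push_cast; ring
        · rw [if_pos hs, if_neg hw, if_neg (fun h => hw h.2)]; simp
      · rw [if_neg hs, if_neg (fun h => hs h.1)]; simp
    rw [Finset.sum_congr rfl fun d₀ hd₀ => Finset.sum_congr rfl fun d₁ hd₁ => hconv d₀ hd₀ d₁ hd₁]
    have hκ0 : ((κ : ℤ)) ≠ 0 := by exact_mod_cast (show κ ≠ 0 by omega)
    have h := hKw σ θ η x hσ hθ (hθc.trans (by linarith)) (by linarith) hη (by linarith) hx ha₀ h2D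
      B₀ B₁ hXB₀ hXB₁ (κ : ℤ) hκ0 ((y : ℕ) : ℝ) hyx (2 * Real.log x) (2 * Real.log x)
      (by positivity) (by positivity) v₀ v₁ hv₀b hv₁b hv₁s ν hν
    refine h.trans ?_
    have hκR : |(((κ : ℤ)) : ℝ)| ≤ 20 * (x : ℝ) ^ (2 * c) := by
      rw [Int.cast_natCast, abs_of_nonneg (Nat.cast_nonneg κ)]
      have : (κ : ℝ) ≤ ⌊(x : ℝ) ^ (2 * c)⌋₊ := by exact_mod_cast hκV
      linarith
    exact hfin _ hκR
  · -- `0 < |κ| ≤ 5(2V+1)`, absolute values of the weights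
    intro κ hκ0 hκH
    have hconv : ∀ d₀ ∈ Icc 1 B₀, ∀ d₁ ∈ Icc 1 B₁,
        (((|(if (Nat.Coprime d₀ q₀ ∧ Nat.Coprime d₁ q₁ ∧
            ((Nat.gcd d₀ d₁ : ℕ) : ℤ) ∣ (q₁ : ℤ) * a₀ - (q₀ : ℤ) * a₁) then
          (if ((x : ℝ) ^ (1 - η) < (d₀ : ℝ) * d₁ ∧ (d₀ : ℝ) * d₁ ≤ (x : ℝ) ^ (1 + θ) ∧
              (x : ℝ) ^ σ < (d₀ : ℝ) ∧ (x : ℝ) ^ σ < (d₁ : ℝ)) then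
            (μ d₀ : ℝ) * Real.log d₀ * ((μ d₁ : ℝ) * Real.log d₁) else 0) else 0 : ℝ)| : ℝ) : ℂ) *
          (𝐞 ((κ : ℝ) * (((y : ℝ) - ν d₀ d₁) / (Nat.lcm d₀ d₁ : ℕ))) : ℂ)) =
        (if ((Nat.Coprime d₀ q₀ ∧ Nat.Coprime d₁ q₁ ∧
              ((Nat.gcd d₀ d₁ : ℕ) : ℤ) ∣ (q₁ : ℤ) * a₀ - (q₀ : ℤ) * a₁) ∧
            ((x : ℝ) ^ (1 - η) < (d₀ : ℝ) * d₁ ∧ (d₀ : ℝ) * d₁ ≤ (x : ℝ) ^ (1 + θ) ∧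
              (x : ℝ) ^ σ < (d₀ : ℝ) ∧ (x : ℝ) ^ σ < (d₁ : ℝ))) then
          u₀ d₀ * u₁ d₁ * Complex.exp (2 * π * Complex.I *
            ((((κ : ℤ) : ℝ) * ((((y : ℕ) : ℝ) - (ν d₀ d₁ : ℝ)) / ((Nat.lcm d₀ d₁ : ℕ) : ℝ)) : ℝ) : ℂ))
        else 0) := by
      intro d₀ hd₀ d₁ hd₁
      have h0 : d₀ ≤ B₀ := (Finset.mem_Icc.1 hd₀).2
      have h1 : d₁ ≤ B₁ := (Finset.mem_Icc.1 hd₁).2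
      have hd₀1 : 1 ≤ d₀ := (Finset.mem_Icc.1 hd₀).1
      have hd₁1 : 1 ≤ d₁ := (Finset.mem_Icc.1 hd₁).1
      have hl0 : 0 ≤ Real.log d₀ := Real.log_nonneg (by exact_mod_cast hd₀1)
      have hl1 : 0 ≤ Real.log d₁ := Real.log_nonneg (by exact_mod_cast hd₁1)
      simp only [hu₀, hu₁, if_pos h0, if_pos h1]
      by_cases hs : (Nat.Coprime d₀ q₀ ∧ Nat.Coprime d₁ q₁ ∧
          ((Nat.gcd d₀ d₁ : ℕ) : ℤ) ∣ (q₁ : ℤ) * a₀ - (q₀ : ℤ) * a₁)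
      · by_cases hw : ((x : ℝ) ^ (1 - η) < (d₀ : ℝ) * d₁ ∧ (d₀ : ℝ) * d₁ ≤ (x : ℝ) ^ (1 + θ) ∧
            (x : ℝ) ^ σ < (d₀ : ℝ) ∧ (x : ℝ) ^ σ < (d₁ : ℝ))
        · rw [if_pos hs, if_pos hw, if_pos ⟨hs, hw⟩, fourierChar_coe_eq_exp, abs_mul, abs_mul,
            abs_mul, abs_of_nonneg hl0, abs_of_nonneg hl1]
          push_cast; ring
        · rw [if_pos hs, if_neg hw, if_neg (fun h => hw h.2)]; simp
      · rw [if_neg hs, if_neg (fun h => hs h.1)]; simp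
    rw [Finset.sum_congr rfl fun d₀ hd₀ => Finset.sum_congr rfl fun d₁ hd₁ => hconv d₀ hd₀ d₁ hd₁]
    have h := hKw σ θ η x hσ hθ (hθc.trans (by linarith)) (by linarith) hη (by linarith) hx ha₀ h2D
      B₀ B₁ hXB₀ hXB₁ κ hκ0 ((y : ℕ) : ℝ) hyx (2 * Real.log x) (2 * Real.log x)
      (by positivity) (by positivity) u₀ u₁ hu₀b hu₁b hu₁s ν hν
    refine h.trans ?_
    have hκR : |((κ : ℤ) : ℝ)| ≤ 20 * (x : ℝ) ^ (2 * c) := by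
      have : ((|κ| : ℤ) : ℝ) ≤ ((5 * (2 * ⌊(x : ℝ) ^ (2 * c)⌋₊ + 1) : ℕ) : ℝ) := by
        exact_mod_cast hκH
      rw [Int.cast_abs] at this
      exact this.trans hV5
    exact hfin _ hκR
  · -- the mass of the weights
    have hm := sum_abs_window_weight_le hB₀1 hB₁1 (Y' := (x : ℝ) ^ (1 - η)) (Z := (x : ℝ) ^ σ)
      (Real.one_le_rpow hx1 (by linarith : 0 ≤ 1 + θ))
      (fun d₀ d₁ => (Nat.Coprime d₀ q₀ ∧ Nat.Coprime d₁ q₁ ∧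
        ((Nat.gcd d₀ d₁ : ℕ) : ℤ) ∣ (q₁ : ℤ) * a₀ - (q₀ : ℤ) * a₁))
      (fun d => (μ d : ℝ) * Real.log d) (fun d => (μ d : ℝ) * Real.log d)
      (fun d hd hdB => abs_moebius_log_le hd hdB) (fun d hd hdB => abs_moebius_log_le hd hdB)
    have hconv : ∀ d₀ ∈ Icc 1 B₀, ∀ d₁ ∈ Icc 1 B₁,
        |(if (Nat.Coprime d₀ q₀ ∧ Nat.Coprime d₁ q₁ ∧
            ((Nat.gcd d₀ d₁ : ℕ) : ℤ) ∣ (q₁ : ℤ) * a₀ - (q₀ : ℤ) * a₁) then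
          (if ((x : ℝ) ^ (1 - η) < (d₀ : ℝ) * d₁ ∧ (d₀ : ℝ) * d₁ ≤ (x : ℝ) ^ (1 + θ) ∧
              (x : ℝ) ^ σ < (d₀ : ℝ) ∧ (x : ℝ) ^ σ < (d₁ : ℝ)) then
            (μ d₀ : ℝ) * Real.log d₀ * ((μ d₁ : ℝ) * Real.log d₁) else 0) else 0 : ℝ)| =
        |(if ((Nat.Coprime d₀ q₀ ∧ Nat.Coprime d₁ q₁ ∧
              ((Nat.gcd d₀ d₁ : ℕ) : ℤ) ∣ (q₁ : ℤ) * a₀ - (q₀ : ℤ) * a₁) ∧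
            ((x : ℝ) ^ (1 - η) < (d₀ : ℝ) * d₁ ∧ (d₀ : ℝ) * d₁ ≤ (x : ℝ) ^ (1 + θ) ∧
              (x : ℝ) ^ σ < (d₀ : ℝ) ∧ (x : ℝ) ^ σ < (d₁ : ℝ))) then
          (μ d₀ : ℝ) * Real.log d₀ * ((μ d₁ : ℝ) * Real.log d₁) else 0 : ℝ)| := by
      intro d₀ _ d₁ _
      by_cases hs : (Nat.Coprime d₀ q₀ ∧ Nat.Coprime d₁ q₁ ∧
          ((Nat.gcd d₀ d₁ : ℕ) : ℤ) ∣ (q₁ : ℤ) * a₀ - (q₀ : ℤ) * a₁)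
      · by_cases hw : ((x : ℝ) ^ (1 - η) < (d₀ : ℝ) * d₁ ∧ (d₀ : ℝ) * d₁ ≤ (x : ℝ) ^ (1 + θ) ∧
            (x : ℝ) ^ σ < (d₀ : ℝ) ∧ (x : ℝ) ^ σ < (d₁ : ℝ))
        · rw [if_pos hs, if_pos hw, if_pos ⟨hs, hw⟩]
        · rw [if_pos hs, if_neg hw, if_neg (fun h => hw h.2)]
      · rw [if_neg hs, if_neg (fun h => hs h.1)]
    rw [Finset.sum_congr rfl fun d₀ hd₀ => Finset.sum_congr rfl fun d₁ hd₁ => hconv d₀ hd₀ d₁ hd₁]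
    refine hm.trans ?_
    have hlogY : Real.log ((x : ℝ) ^ (1 + θ)) ≤ 2 * Real.log x := by
      rw [Real.log_rpow hx0]; nlinarith
    have hY0 : 0 ≤ (x : ℝ) ^ (1 + θ) := by positivity
    have hlB₀ : 0 ≤ Real.log B₀ := Real.log_nonneg (by exact_mod_cast hB₀1)
    have hlB₁ : 0 ≤ Real.log B₁ := Real.log_nonneg (by exact_mod_cast hB₁1)
    calc Real.log B₀ * Real.log B₁ * ((x : ℝ) ^ (1 + θ) * (1 + Real.log ((x : ℝ) ^ (1 + θ))))
        ≤ (2 * Real.log x) * (2 * Real.log x) * ((x : ℝ) ^ (1 + θ) * (3 * Real.log x)) := by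
          refine mul_le_mul (mul_le_mul hlogB₀ hlogB₁ hlB₁ (by positivity)) ?_ (by
            have : 0 ≤ Real.log ((x : ℝ) ^ (1 + θ)) := by rw [Real.log_rpow hx0]; positivity
            positivity) (by positivity)
          refine mul_le_mul_of_nonneg_left ?_ hY0
          linarith
      _ = 12 * Real.log x ^ 3 * (x : ℝ) ^ (1 + θ) := by ring
  · -- the final numerics
    have hPQ : (x : ℝ) ^ (1 + θ) ≤ (x : ℝ) ^ (1 - c) * (x : ℝ) ^ (2 * c) := by
      calc (x : ℝ) ^ (1 + θ) = (x : ℝ) ^ (1 + θ - 2 * c) * (x : ℝ) ^ (2 * c) := by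
            rw [← Real.rpow_add hx0]; ring_nf
        _ ≤ (x : ℝ) ^ (1 - c) * (x : ℝ) ^ (2 * c) := by
            refine mul_le_mul_of_nonneg_right ?_ (by positivity)
            exact Real.rpow_le_rpow_of_exponent_le hx1 (by linarith)
    have hV1R : (1 : ℝ) ≤ ⌊(x : ℝ) ^ (2 * c)⌋₊ := by exact_mod_cast hV1
    exact psi_numerics hL1 hV1R hKw0 (by positivity) (by positivity) hlogV hlog2V hV3 hPQ hEdef

end Psi

/-! ### The balanced window is `o(x)` -/

/-- An `o(x)` criterion: `|f(x)| ≤ g(x) x` eventually with `g → 0`. [folklore] -/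
theorem isLittleO_of_abs_le_mul {f g : ℕ → ℝ} (hfg : ∀ᶠ x : ℕ in atTop, |f x| ≤ g x * x)
    (hg : Tendsto g atTop (nhds 0)) : f =o[atTop] fun x : ℕ => (x : ℝ) := by
  refine Asymptotics.isLittleO_iff.2 fun δ hδ => ?_
  filter_upwards [hfg, hg.eventually (eventually_lt_nhds hδ)] with x hx hgx
  rw [Real.norm_eq_abs, Real.norm_eq_abs, abs_of_nonneg (Nat.cast_nonneg (α := ℝ) x)]
  exact hx.trans (mul_le_mul_of_nonneg_right hgx.le (Nat.cast_nonneg x))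

/-- `(log x)^6 x^{-c} → 0` along the naturals, for `c > 0`. [folklore] -/
theorem tendsto_log_pow_six_mul_rpow_neg {c : ℝ} (hc : 0 < c) :
    Tendsto (fun x : ℕ => Real.log x ^ 6 * (x : ℝ) ^ (-c)) atTop (nhds 0) := by
  have h := (isLittleO_log_rpow_rpow_atTop (6 : ℝ) hc).tendsto_div_nhds_zero
  have h' := h.comp tendsto_natCast_atTop_atTop
  refine (h'.congr' ?_)
  filter_upwards [eventually_gt_atTop 0] with x hx
  have hx0 : (0 : ℝ) < x := by exact_mod_cast hx
  simp only [Function.comp]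
  rw [show ((6 : ℝ)) = ((6 : ℕ) : ℝ) by norm_num, Real.rpow_natCast, Real.rpow_neg hx0.le,
    div_eq_mul_inv]

/-- The exponent bookkeeping of the Duke–Friedlander–Iwaniec range: with `g = (11σ − 5)/48 > 0`,
`ε = g/4`, `c = g/16` and `0 < θ, η ≤ c`, `σ ≤ 1/2`:
`η + 7(1+θ)/8 + (1+θ−σ)(11/48+ε) + (11/4)c ≤ 1 − c`. [folklore] -/
theorem exponent_le {σ θ η : ℝ} (hσ : 5 / 11 < σ) (hσ' : σ ≤ 1 / 2)
    (hθc : θ ≤ (11 * σ - 5) / 48 / 16) (hηc : η ≤ (11 * σ - 5) / 48 / 16) :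
    η + (1 + θ) * (7 / 8) + (1 + θ - σ) * (11 / 48 + (11 * σ - 5) / 48 / 4) +
        (11 / 4) * ((11 * σ - 5) / 48 / 16) ≤ 1 - (11 * σ - 5) / 48 / 16 := by
  nlinarith [mul_le_mul_of_nonneg_right hθc (by nlinarith : (0 : ℝ) ≤ 11 / 48 + (11 * σ - 5) / 48 / 4)]

section Main

variable {q₀ q₁ : ℕ} {a₀ a₁ : ℤ}

/-- **The balanced divisor window for a pair of linear congruences is `o(x)`** (the
Duke–Friedlander–Iwaniec range).  For `q₀, q₁ ≥ 1`, `gcd(qᵢ, aᵢ) = 1`, `Δ = q₁a₀ − q₀a₁ ≠ 0` and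
`5/11 < σ < 1/2` there is `c > 0` such that for all `0 < θ, η ≤ c`, every threshold `n₀` and all box
sides with `x^{1−σ/2} ≤ Bᵢ(x) ≤ x²` eventually,
`Σ_{d₀ ≤ B₀(x)} Σ_{d₁ ≤ B₁(x)} [x^{1−η} < d₀d₁ ≤ x^{1+θ}][x^σ < d₀][x^σ < d₁] μ(d₀)log d₀ μ(d₁)log d₁
   · #{n₀ < n ≤ x : d₀ ∣ q₀n + a₀, d₁ ∣ q₁n + a₁} = o(x)`. [folklore] -/
theorem window_pair_sum_isLittleO (hq₀ : 0 < q₀) (hq₁ : 0 < q₁)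
    (hc₀ : IsCoprime (q₀ : ℤ) a₀) (hc₁ : IsCoprime (q₁ : ℤ) a₁)
    (hΔ : (q₁ : ℤ) * a₀ - (q₀ : ℤ) * a₁ ≠ 0) {σ : ℝ} (hσ : 5 / 11 < σ) (hσ' : σ < 1 / 2) :
    ∃ c : ℝ, 0 < c ∧ ∀ θ η : ℝ, 0 < θ → θ ≤ c → 0 < η → η ≤ c →
      ∀ (n₀ : ℕ) (B₀ B₁ : ℕ → ℕ),
      (∀ᶠ x : ℕ in atTop, (x : ℝ) ^ (1 - σ / 2) ≤ B₀ x ∧ (B₀ x : ℝ) ≤ (x : ℝ) ^ 2 ∧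
        (x : ℝ) ^ (1 - σ / 2) ≤ B₁ x ∧ (B₁ x : ℝ) ≤ (x : ℝ) ^ 2) →
      (fun x : ℕ => ∑ d₀ ∈ Icc 1 (B₀ x), ∑ d₁ ∈ Icc 1 (B₁ x),
        (if ((x : ℝ) ^ (1 - η) < (d₀ : ℝ) * d₁ ∧ (d₀ : ℝ) * d₁ ≤ (x : ℝ) ^ (1 + θ) ∧
            (x : ℝ) ^ σ < (d₀ : ℝ) ∧ (x : ℝ) ^ σ < (d₁ : ℝ)) then
          (μ d₀ : ℝ) * Real.log d₀ * ((μ d₁ : ℝ) * Real.log d₁) else 0) *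
        ((((Ioc n₀ x).filter (fun n : ℕ =>
          (d₀ : ℤ) ∣ (q₀ : ℤ) * n + a₀ ∧ (d₁ : ℤ) ∣ (q₁ : ℤ) * n + a₁)).card : ℕ) : ℝ))
      =o[atTop] fun x : ℕ => (x : ℝ) := by
  classical
  -- constants
  have hg0 : 0 < (11 * σ - 5) / 48 := by linarith
  obtain ⟨Kw, hKw0, hKw⟩ := LinearPairKloosterman.norm_windowSum_le q₀ q₁ a₀ a₁ hq₀ hq₁ hc₀ hc₁ hΔ
    (ε := (11 * σ - 5) / 48 / 4) (by positivity)
  obtain ⟨C₁, hC₁0, hC₁⟩ := MoebiusCoprimeTail.abs_sum_Ioc_coprime_moebius_div_le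
    (B := 6) (by norm_num)
  obtain ⟨C₂, hC₂0, hC₂⟩ := MoebiusCoprimeTail.abs_sum_Ioc_coprime_moebius_mul_log_div_le
    (B := 6) (by norm_num)
  refine ⟨(11 * σ - 5) / 48 / 16, by positivity, ?_⟩
  intro θ η hθ hθc hη hηc n₀ B₀ B₁ hB
  have hσ0 : 0 < σ := by linarith
  -- the solution map
  have hex : ∀ d₀ d₁ : ℕ, ∃ n : ℕ, (0 < d₀ ∧ 0 < d₁ ∧ (Nat.Coprime d₀ q₀ ∧ Nat.Coprime d₁ q₁ ∧
      ((Nat.gcd d₀ d₁ : ℕ) : ℤ) ∣ (q₁ : ℤ) * a₀ - (q₀ : ℤ) * a₁)) →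
        (d₀ : ℤ) ∣ (q₀ : ℤ) * n + a₀ ∧ (d₁ : ℤ) ∣ (q₁ : ℤ) * n + a₁ := by
    intro d₀ d₁
    by_cases h : (0 < d₀ ∧ 0 < d₁ ∧ (Nat.Coprime d₀ q₀ ∧ Nat.Coprime d₁ q₁ ∧
        ((Nat.gcd d₀ d₁ : ℕ) : ℤ) ∣ (q₁ : ℤ) * a₀ - (q₀ : ℤ) * a₁))
    · obtain ⟨hd₀, hd₁, hs⟩ := h
      have hsol := (pair_solvable_iff (d₀ := d₀) (d₁ := d₁) hc₀ hc₁).2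
        ⟨Nat.isCoprime_iff_coprime.2 hs.1, Nat.isCoprime_iff_coprime.2 hs.2.1, hs.2.2⟩
      obtain ⟨ν, -, hν₀, hν₁⟩ := exists_nat_sol_lt_lcm hd₀ hd₁ hsol
      exact ⟨ν, fun _ => ⟨hν₀, hν₁⟩⟩
    · exact ⟨0, fun h' => absurd h' h⟩
  choose ν hν using hex
  have hν' : ∀ d₀ d₁ : ℕ, 0 < d₀ → 0 < d₁ → Nat.Coprime d₀ q₀ → Nat.Coprime d₁ q₁ →
      ((Nat.gcd d₀ d₁ : ℕ) : ℤ) ∣ (q₁ : ℤ) * a₀ - (q₀ : ℤ) * a₁ →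
        (d₀ : ℤ) ∣ (q₀ : ℤ) * (ν d₀ d₁) + a₀ ∧ (d₁ : ℤ) ∣ (q₁ : ℤ) * (ν d₀ d₁) + a₁ :=
    fun d₀ d₁ h0 h1 h2 h3 h4 => hν d₀ d₁ ⟨h0, h1, h2, h3, h4⟩
  -- names
  set Δ : ℤ := (q₁ : ℤ) * a₀ - (q₀ : ℤ) * a₁ with hΔdef
  set D : ℕ := Δ.natAbs with hDdef
  set KM : ℝ := (D.divisors.card : ℝ) * (C₁ * Real.log D + C₂) *
    (4 : ℝ) ^ q₁.primeFactors.card * (2 / σ) ^ (6 : ℝ) * 3 ^ 5 with hKMdef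
  set CΨ : ℝ := 48400 * Kw + 144 with hCΨdef
  set c : ℝ := (11 * σ - 5) / 48 / 16 with hcdef
  have hc0 : 0 < c := by rw [hcdef]; positivity
  have hexp : η + (1 + θ) * (7 / 8) + (1 + θ - σ) * (11 / 48 + (11 * σ - 5) / 48 / 4) +
      (11 / 4) * c ≤ 1 - c := exponent_le hσ hσ'.le hθc hηc
  -- eventual conditions
  have hev₁ : ∀ᶠ x : ℕ in atTop, 6 ≤ x := eventually_ge_atTop 6
  have hev₂ : ∀ᶠ x : ℕ in atTop, n₀ ≤ x := eventually_ge_atTop n₀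
  have hev₃ : ∀ᶠ x : ℕ in atTop, a₀.natAbs ≤ x := eventually_ge_atTop _
  have hev₄ : ∀ᶠ x : ℕ in atTop, (2 : ℝ) * D ≤ (x : ℝ) ^ σ :=
    ((tendsto_rpow_atTop hσ0).comp tendsto_natCast_atTop_atTop).eventually_ge_atTop _
  have hev₅ : ∀ᶠ x : ℕ in atTop, (D : ℝ) ≤ (x : ℝ) ^ (σ / 2) :=
    ((tendsto_rpow_atTop (by linarith)).comp tendsto_natCast_atTop_atTop).eventually_ge_atTop _
  -- the bound `|W(x)| ≤ (KM / log x + 2 CΨ (log x)^6 x^{-c}) x`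
  refine isLittleO_of_abs_le_mul (g := fun x : ℕ => KM / Real.log x +
    2 * CΨ * (Real.log x ^ 6 * (x : ℝ) ^ (-c))) ?_ ?_
  · filter_upwards [hev₁, hev₂, hev₃, hev₄, hev₅, hB] with x hx₆ hxn hxa hx₄ hx₅ hBx
    obtain ⟨hB₀, hB₀', hB₁, hB₁'⟩ := hBx
    have hx6 : (6 : ℝ) ≤ x := by exact_mod_cast hx₆
    have hx0 : (0 : ℝ) < x := by linarith
    have hx1 : (1 : ℝ) ≤ x := by linarith
    have hx₃ : 3 ≤ x := le_trans (by norm_num) hx₆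
    have hxa' : |(a₀ : ℝ)| ≤ x := by
      rw [← Int.cast_abs, ← Nat.cast_natAbs]; exact_mod_cast hxa
    have hL1 : 1 ≤ Real.log x := by
      rw [Real.le_log_iff_exp_le hx0]
      have := Real.exp_one_lt_d9; linarith
    -- decomposition
    rw [window_sum_decomp hc₀ hc₁ ν hν' _ (B₀ x) (B₁ x) hxn]
    -- main term
    have hM : |∑ d₀ ∈ Icc 1 (B₀ x), ∑ d₁ ∈ Icc 1 (B₁ x),
        (if (Nat.Coprime d₀ q₀ ∧ Nat.Coprime d₁ q₁ ∧ ((Nat.gcd d₀ d₁ : ℕ) : ℤ) ∣ Δ) then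
          (if ((x : ℝ) ^ (1 - η) < (d₀ : ℝ) * d₁ ∧ (d₀ : ℝ) * d₁ ≤ (x : ℝ) ^ (1 + θ) ∧
              (x : ℝ) ^ σ < (d₀ : ℝ) ∧ (x : ℝ) ^ σ < (d₁ : ℝ)) then
            (μ d₀ : ℝ) * Real.log d₀ * ((μ d₁ : ℝ) * Real.log d₁) else 0) else 0) /
          (Nat.lcm d₀ d₁ : ℕ)| ≤ KM / Real.log x := by
      have hrw : ∀ d₀ ∈ Icc 1 (B₀ x), ∀ d₁ ∈ Icc 1 (B₁ x),
          (if (Nat.Coprime d₀ q₀ ∧ Nat.Coprime d₁ q₁ ∧ ((Nat.gcd d₀ d₁ : ℕ) : ℤ) ∣ Δ) then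
            (if ((x : ℝ) ^ (1 - η) < (d₀ : ℝ) * d₁ ∧ (d₀ : ℝ) * d₁ ≤ (x : ℝ) ^ (1 + θ) ∧
                (x : ℝ) ^ σ < (d₀ : ℝ) ∧ (x : ℝ) ^ σ < (d₁ : ℝ)) then
              (μ d₀ : ℝ) * Real.log d₀ * ((μ d₁ : ℝ) * Real.log d₁) else 0) else 0) /
            (Nat.lcm d₀ d₁ : ℕ) =
          (μ d₀ : ℝ) * Real.log d₀ / d₀ * ((if Nat.Coprime d₀ q₀ then (1 : ℝ) else 0) *
            (if ((x : ℝ) ^ (1 - η) < (d₀ : ℝ) * d₁ ∧ (d₀ : ℝ) * d₁ ≤ (x : ℝ) ^ (1 + θ) ∧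
                (x : ℝ) ^ σ < (d₀ : ℝ) ∧ (x : ℝ) ^ σ < (d₁ : ℝ)) then
              (if Nat.Coprime d₁ q₁ ∧ ((Nat.gcd d₀ d₁ : ℕ) : ℤ) ∣ Δ then
                (μ d₁ : ℝ) * Real.log d₁ * ((Nat.gcd d₀ d₁ : ℝ) / d₁) else 0) else 0)) :=
        fun d₀ hd₀ d₁ hd₁ => mainTerm_summand_eq Δ σ θ η (x : ℝ) (Finset.mem_Icc.1 hd₀).1
          (Finset.mem_Icc.1 hd₁).1
      rw [Finset.sum_congr rfl fun d₀ hd₀ => Finset.sum_congr rfl fun d₁ hd₁ => hrw d₀ hd₀ d₁ hd₁]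
      exact abs_doubleSum_le q₀ hq₁ hΔ hC₁0 hC₂0 hC₁ hC₂ hσ0 θ η hx₃ hx₄ hx₅ hB₀' (B₁ x)
    -- sawtooth sums
    have hΨ : ∀ y : ℕ, y ≤ x → |∑ d₀ ∈ Icc 1 (B₀ x), ∑ d₁ ∈ Icc 1 (B₁ x),
        (if (Nat.Coprime d₀ q₀ ∧ Nat.Coprime d₁ q₁ ∧ ((Nat.gcd d₀ d₁ : ℕ) : ℤ) ∣ Δ) then
          (if ((x : ℝ) ^ (1 - η) < (d₀ : ℝ) * d₁ ∧ (d₀ : ℝ) * d₁ ≤ (x : ℝ) ^ (1 + θ) ∧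
              (x : ℝ) ^ σ < (d₀ : ℝ) ∧ (x : ℝ) ^ σ < (d₁ : ℝ)) then
            (μ d₀ : ℝ) * Real.log d₀ * ((μ d₁ : ℝ) * Real.log d₁) else 0) else 0) *
          saw (((y : ℝ) - ν d₀ d₁) / (Nat.lcm d₀ d₁ : ℕ))| ≤
        CΨ * Real.log x ^ 6 * (x : ℝ) ^ (1 - c) := fun y hy =>
      abs_psi_le hKw0.le hKw hσ0 (by linarith) hc0 (by rw [hcdef]; nlinarith) (by rw [hcdef]; nlinarith)
        hθ hθc hη hηc hexp hx₆ hxa' hx₄ hB₀ hB₀' hB₁ hB₁' ν hν' hy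
    have hΨ₁ := hΨ n₀ hxn
    have hΨ₂ := hΨ x le_rfl
    -- combine
    have hxsub : ((x - n₀ : ℕ) : ℝ) ≤ x := by exact_mod_cast Nat.sub_le x n₀
    have hxc : (x : ℝ) ^ (1 - c) = (x : ℝ) ^ (-c) * x := by
      rw [show (1 - c : ℝ) = -c + 1 by ring, Real.rpow_add hx0, Real.rpow_one]
    have hKM0 : 0 ≤ KM := by
      rw [hKMdef]
      have : (1 : ℝ) ≤ D := by exact_mod_cast Int.natAbs_pos.2 hΔ
      have : 0 ≤ Real.log D := Real.log_nonneg this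
      positivity
    have hCΨ0 : 0 ≤ CΨ := by rw [hCΨdef]; positivity
    have hlog0 : 0 < Real.log x := by linarith
    calc |((x - n₀ : ℕ) : ℝ) * _ + _ - _|
        ≤ |((x - n₀ : ℕ) : ℝ) * _ + _| + |_| := abs_sub _ _
      _ ≤ |((x - n₀ : ℕ) : ℝ) * _| + |_| + |_| := by gcongr; exact abs_add_le _ _
      _ ≤ (x : ℝ) * (KM / Real.log x) + CΨ * Real.log x ^ 6 * (x : ℝ) ^ (1 - c) +
          CΨ * Real.log x ^ 6 * (x : ℝ) ^ (1 - c) := by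
          refine add_le_add (add_le_add ?_ hΨ₁) hΨ₂
          rw [abs_mul, abs_of_nonneg (Nat.cast_nonneg _)]
          exact mul_le_mul hxsub hM (abs_nonneg _) (Nat.cast_nonneg _)
      _ = (KM / Real.log x + 2 * CΨ * (Real.log x ^ 6 * (x : ℝ) ^ (-c))) * x := by
          rw [hxc]; ring
  · -- the majorant tends to `0`
    have h1 : Tendsto (fun x : ℕ => KM / Real.log x) atTop (nhds 0) := by
      have hlog : Tendsto (fun x : ℕ => Real.log x) atTop atTop :=
        Real.tendsto_log_atTop.comp tendsto_natCast_atTop_atTop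
      have h := (tendsto_inv_atTop_zero.comp hlog).const_mul KM
      rw [mul_zero] at h
      refine h.congr fun x => ?_
      simp only [Function.comp, div_eq_mul_inv]
    have h2 := (tendsto_log_pow_six_mul_rpow_neg hc0).const_mul (2 * CΨ)
    rw [mul_zero] at h2
    have := h1.add h2
    rw [add_zero] at this
    exact this

end Main

end Literature.NumberTheory.Sieve.LinearPairMoebius
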